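import Summits.ResolutionOfSingularities.ResolutionOfSingularities.Theorems.FrobeniusClosingPatchingRelPerfectDepthFlagTargets
import Summits.ResolutionOfSingularities.ResolutionOfSingularities.Theorems.FrobeniusClosingPatchingRelPerfectDepthFlagPrephasePeel
import Summits.ResolutionOfSingularities.ResolutionOfSingularities.Theorems.FrobeniusClosingPatchingRelPerfectDepthFlagPrephaseCJS
import Summits.ResolutionOfSingularities.ResolutionOfSingularities.Theorems.FrobeniusClosingPatchingRelPerfectDepthFlagPrephaseBad
import HarnessLib

/-!
# Crux `PatchingRelPerfect` (stmt-ResolutionOfSingularities-16161), chain W5.2 — TargetsF6 stage 1: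
# T6-E1a «DIVISORIAL PRE-PHASE» `DepthTargets.StageOnePrephase₃` CLOSED BY NAME, modulo F-32bR

[OURS · L1 W5.2 · TargetsF6 (res-L1-w52-plan-1 g8, tree `…DepthFlagTargets`, res-D-pv-059 AS lead-2), T6-E1a (res-type-049)] NOT statements of
the manuscript under review; the ONLY external input is the named fact F-32bR `CossartJannsenSaito2020EmbeddedSequenceB` (Cossart–Jannsen–Saito
2020, Thm. 1.4 with the Thm. 6.9 (a) per-step clause), taken as a HYPOTHESIS — the result is CONDITIONAL on it, exactly as the other E-side
drivers of this chain (`WeightTwoPrincipal₃`, `WeightTwoBoundaryJR₃`).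

ASSEMBLY (`stageOnePrephase₃_of_cjsB`): for a flag `𝔟 ≤ R₁` on an integral Noetherian regular excellent threefold `E` —
(0) the BAD SET `X` (brick 3, `DepthFlagBad.exists_badSet`: union of the prime divisors of multiplicity `≥ 2` in `𝔟` on which `R₁`
vanishes; closed, of dimension `≤ 2`, `𝔟 ⊆ 𝓘(X)²`, `R₁ ⊆ 𝓘(X)`); (1) ONE Cossart–Jannsen–Saito run over `X` (F-32bR), along which the flag
is transported by weight-two flag-permissible steps (brick 2, `DepthFlagCJS.cjs_flag_transport`, instantiated at `P := IsFlagSeq`);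
(2) after it every bad prime divisor is REGULAR (brick 3, `DepthFlagBad.isRegular_bad_after_cjs`: it lies on the regular strict transform
or on the strict-normal-crossings boundary); (3) the PEEL loop (brick 1, `DepthFlagPeel.peel_loop`) divides the flag by its bad regular prime
divisors until none is left; (4) «no bad codimension-one point» is the scope condition (`DepthFlagPeel.flagScope_of_forall_coheight_one`).

AI-written; AI review is weaker than expert review.

## References
* V. Cossart, U. Jannsen, S. Saito, *Desingularization: Invariants and Strategy*, LNM 2270 (2020), Thm. 1.4, Cor. 1.5, (6.2), Thm. 6.9 (a).
  [CossartJannsenSaito2020]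
* V. Cossart, O. Piltant, J. Algebra 320 (2008), proof of Prop. 4.2, Prop. 4.4. [CossartPiltant2008]
* H. Kawanoue, K. Matsuki, arXiv:1205.4556, §2. [KawanoueMatsuki2016]
-/

-- `Summit.<Summit>.<Sub>.Theorems` with `Sub = Summit` (single-conjunct summit, D-0017)
set_option linter.dupNamespace false

noncomputable section

open CategoryTheory CategoryTheory.Limits AlgebraicGeometry TopologicalSpace IsLocalRing
open Literature.AlgebraicGeometry.Resolution Scheme.IdealSheafData

namespace Summit.ResolutionOfSingularities.ResolutionOfSingularities.Theorems

universe u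

namespace DepthTargets

/-- An effective Cartier divisor on a nonempty scheme is not the zero ideal sheaf. [folklore] -/
private theorem ne_bot_of_isEffectiveCartier {W : Scheme.{u}} [Nonempty W] {J : W.IdealSheafData} (hJ : IsEffectiveCartier J) :
    J ≠ ⊥ := by
  intro h0
  obtain ⟨U, hxU, g, hg, hU⟩ := hJ (Classical.arbitrary W)
  rw [h0, Scheme.IdealSheafData.ideal_bot, Pi.bot_apply, eq_comm, Ideal.span_singleton_eq_bot] at hU
  subst hU
  haveI : Nonempty (U : W.Opens) := ⟨⟨_, hxU⟩⟩
  exact zero_notMem_nonZeroDivisors hg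

/-- [OURS · L1 W5.2 · TargetsF6 T6-E1a] **THE DIVISORIAL PRE-PHASE, BY NAME — modulo F-32bR**: Cossart–Jannsen–Saito 2020 Thm. 1.4 (as the
tree's `CossartJannsenSaito2020EmbeddedSequenceB`) implies `StageOnePrephase₃`: every flag `𝔟 ≤ R₁` (`𝔟 ≠ ⊥` locally principal) on an
integral Noetherian regular excellent threefold is carried by weight-two flag-permissible blowings up (`IsFlagSeq`) to a flag satisfying
the SCOPE CONDITION `FlagScope`, on an integral Noetherian regular excellent threefold (`FlagState₃`).
[cite: CossartJannsenSaito2020, Thm. 1.4, (6.2), Thm. 6.9 (a)] [cite: CossartPiltant2008, proof of Prop. 4.2] -/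
theorem stageOnePrephase₃_of_cjsB (hCJS : CossartJannsenSaito2020EmbeddedSequenceB.{u}) : StageOnePrephase₃.{u} := by
  intro E _ _ hE hexc hdim 𝔟 R₁ h𝔟 hlp hle
  classical
  -- (0) the bad set
  obtain ⟨X, hdimX, hX𝔟, h𝔟X, hRX, hbad⟩ := DepthFlagBad.exists_badSet hE hdim (R₁ := R₁) h𝔟 hlp
  have hXne : (X : Set E) ≠ Set.univ := fun h =>
    not_mem_support_genericPoint h𝔟 (hX𝔟 (show genericPoint E ∈ (X : Set E) from h ▸ Set.mem_univ _))
  -- (1) the Cossart–Jannsen–Saito run over `X`, and the flag transport along it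
  obtain ⟨Z₁, π, X₁, B₁, hT, hZ₁, -, hsurj, -, hX₁reg, hB₁, htot, -⟩ := hCJS.of_isClosed E hE hexc (X : Set E) X.isClosed hdimX
  obtain ⟨hint, hnoeth, hZ₁', hexc₁, hdim₁, -, 𝔟₁, R₁₁, hseq₁, h𝔟₁c, hle₁, -, -, hstalk⟩ :=
    DepthFlagCJS.cjs_flag_transport (fun ⦃E' E : Scheme.{u}⦄ (ρ : E' ⟶ E) 𝔟 R₁ 𝔟' R₁' => IsFlagSeq ρ 𝔟 R₁ 𝔟' R₁')
      (fun ⦃E'' E' E : Scheme.{u}⦄ τ ρ 𝔟 R₁ 𝔟' R₁' C h hC h2 h1 hτ => IsFlagSeq.cons τ ρ 𝔟 R₁ 𝔟' R₁' C h hC h2 h1 hτ)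
      hE hexc hdim (IsFlagSeq.nil 𝔟 R₁) (hlp.isEffectiveCartier_of_ne_bot h𝔟) hle X.isClosed h𝔟X hRX hT
  haveI := hint
  haveI := hnoeth
  have h𝔟₁ne : 𝔟₁ ≠ ⊥ := ne_bot_of_isEffectiveCartier h𝔟₁c
  -- (2) every bad prime divisor upstairs is regular
  have hreg := DepthFlagBad.isRegular_bad_after_cjs hZ₁ hsurj X.isClosed hXne hbad htot hX₁reg hB₁ hstalk
  -- (3) the peel loop
  have hTmem : ∀ ζ : Z₁, Order.coheight ζ = 1 → ζ ∈ 𝔟₁.support → ζ ∈ (finite_divisorialPoints h𝔟₁ne).toFinset :=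
    fun ζ hζ hζs => (Set.Finite.mem_toFinset _).mpr ⟨hζs, hζ⟩
  obtain ⟨𝔟', R₁', hseq', h𝔟'c, h𝔟'ne, hle', -, -, hgood⟩ :=
    DepthFlagPeel.peel_loop hZ₁ (fun ⦃E' E : Scheme.{u}⦄ (ρ : E' ⟶ E) 𝔟 R₁ 𝔟' R₁' => IsFlagSeq ρ 𝔟 R₁ 𝔟' R₁')
      (fun ⦃E'' E' E : Scheme.{u}⦄ τ ρ 𝔟 R₁ 𝔟' R₁' C h hC h2 h1 hτ => IsFlagSeq.cons τ ρ 𝔟 R₁ 𝔟' R₁' C h hC h2 h1 hτ)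
      ((finite_divisorialPoints h𝔟₁ne).toFinset) _ hseq₁ h𝔟₁c h𝔟₁ne hle₁ hTmem hreg le_rfl
  -- (4) conclusion
  refine ⟨Z₁, π, 𝔟', R₁', by simpa using hseq', ⟨hint, hnoeth, hZ₁, hexc₁, hdim₁, h𝔟'ne, h𝔟'c.isLocallyPrincipal, hle'⟩, ?_⟩
  exact fun x hx => DepthFlagPeel.flagScope_of_forall_coheight_one hZ₁ h𝔟'ne hgood x hx

end DepthTargets

end Summit.ResolutionOfSingularities.ResolutionOfSingularities.Theorems

end
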